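import Summits.ABC.IUTFork.Repair.RHSigmaMassGap
import HarnessLib

/-!
# R-H ROUND 2 EXPONENT PROGRAMME (EXP-SPEC v0), piece F5 — `μ` EXPLICIT AT THE DATUM: the relative tolerance [MU] «`B_triv(σᶜ) ≤ (1−μ₀)·T.gap + Tol`»
# in MASS currency («`mass(σ) ≥ μ₀·T.gap − Tol`»), the `μ₀ = 1` regression, the empty stratum, monotonicity in `μ₀`

PROOF-ONLY file (0 definitions, 0 `Prop` facts, no instance, no notation) of the abc-iut cell, rung LADDER-ABC:A2.RESCUE.H; seat abc-iut-rh2-T-1 (gen 2,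
«GO rh2-T-1 EXP-END»); companion of `Conditional/AbcExpOfSigmaMassPointwise.lean` (the three θ-cut binders [LIC-C]·[MU-C]·[CONE-C] ⟹ the `1/μ₀`-dilated
display at every admissible `(P, l)`) and of the endpoint `Conditional/AbcExpOfSigmaMassContent.lean` (`ABCWithExponent (1/μ₀)`). EXP-SPEC §0: «publish
`μ` as an explicit function of the datum: `μ(T) := mass(Σ_data)(T)/T.gap = Σ_v S(j₀(v))·h_v/(S(l⋆)·Σ_v h_v)`; [MU-C] at `σ := Σ_data` reads `μ(T) ≥ μ₀ − Tol/M`».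
COMPOSED BY NAME (nothing re-typed): abc-iut-rh2-xi-1's `Repair.RH.OffSigma.OffSigmaTolerance κ A T B := B ≤ κ·T.gap + A` (p469145); this seat's gen-0
`RH.SigmaMass.offTrivialMass` / `onTrivialMass` / `onTrivialMass_add_offTrivialMass` / `offTrivialMass_empty` (p477034) and `SigmaMass.tol` (p477154);
abc-iut-rh2-w-1's junction `RH.CellWeights.onTrivialMass_add_offTrivialMass_chosen_eq_gap` (p478601: at the bed of a genuine datum with the chosen
realising ideles `mass(σ) + B_triv(σᶜ) = T.gap`); abc-iut-c312-7's `bridgeHyps_settingPrVolSharp_of_ideles`; abc-iut-S-d2's `PointDict.gap_eq`.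

WHAT IS TYPED (`Tol(P,l) = ((l+1)/4)·5·d*·l`; at the bed = the sharp print-normalised setting at `pilotDataOfK T.D T.K` with the chosen ideles, ANY context, ANY `σ`):
* **`offSigmaTolerance_offTrivialMass_chosen_iff`** — [MU] `OffSigmaTolerance (1−μ₀) (Tol(P,l)) T (B_triv(σᶜ))` ⟺ **`μ₀·T.gap ≤ mass(σ) + Tol(P,l)`**;
  READING: with `μ(T) := mass(Σ_data)/T.gap`, «`μ(T) ≥ μ₀ − Tol(P,l)/T.gap`»; for the initial-label-segment strata of every kept row (SLICE.md)
  `mass(Σ_data) = (Σᶠ_v S(j₀(v))·h_v)/l⋆`, `S(n) = n(n−1)(2n+5)/6`, is w-1's `RH.CellWeights.mass_labelSegment_eq` (p477616; CITED, not restated), whence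
  `μ(T) = Σ_v S(j₀(v))·h_v/(S(l⋆)·Σ_v h_v)` — the column MIN-SLICE (iii) tabulates (μ₄ median 0.526 on the 137-bed, 1/μ₄ ≤ 3.26; never in window there).
* `offSigmaTolerance_sub_self_iff` — THE `μ₀ = 1` REGRESSION: `OffSigmaTolerance (1 − 1) A T B ⟺ B ≤ A`, i.e. [MU-C]|_{μ₀=1} IS the no-loss [THR-C] of the
  record endpoint `abc_of_licenceOn_of_offTrivialMass_le_content_hregC` (p477900).
* `offSigmaTolerance_offTrivialMass_empty_chosen_iff` — THE EMPTY STRATUM: [MU] at `σ = ∅` ⟺ **`μ₀·T.gap ≤ Tol(P,l)`** (`mass(∅) = 0`): for every FIXED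
  `μ₀ > 0` the licence-free stratum passes only at gap `≤ Tol(P,l)/μ₀` (bounded height at each `l`; `T.gap = ((l+1)/24 − 1/(2l))·log q^{∤{2,l}}`,
  `Tol = 691200·d_mod·l(l+1)`) — rh2-ref-3's μ₀-family sanity as a kernel sentence: the pointwise theorem is not junk-inhabited high on the content locus.
* `offSigmaTolerance_mono_kappa` (+ `gap_nonneg_of_three_le`) — for `T.gap ≥ 0` (true at `λ ∈ U_X`, `l ≥ 3`), `κ ≤ κ'` ⟹ [MU]_κ ⟹ [MU]_{κ'}: a SMALLER
  `μ₀` is a WEAKER hypothesis (paid for by a more dilated display `1/μ₀`).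
HONEST FRAMING: identities/inequalities about OUR typed quantities; [MU] is an ASSUMPTION SHAPE, never asserted; nothing here asserts that abc is proved
or refuted or that [IUTchIII] Cor. 3.12 holds or fails anywhere; no side taken on any author; typed ≠ proved; computed ≠ proved.
[cite: Mochizuki2012, IUTchIII Cor. 3.12 p. 173–174; IUTchIV Thm. 1.10 Steps (viii)–(x) p. 30–32, Cor. 2.2 (ii) p. 46] [cite: DupuyHilado2025, §3.3, §3.9]
[claim: Mochizuki2012, status: disputed] for every IUT locution. Axioms: standard.
-/

noncomputable section

open Set Function NumberField IsDedekindDomain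

namespace Summit.ABC.IUTFork.Conditional.SigmaMass

open Summit.ABC.IUTFork.Thm311 Summit.ABC.IUTFork.Thm311.Real Summit.ABC.IUTFork.Cor312 Summit.ABC.IUTFork.Cor312.Setting
  Summit.ABC.IUTFork.Cor312Vol Summit.ABC.IUTFork.Cor312Prov Literature.IUT.LogThetaLattice Literature.IUT.LogVolume
  Literature.IUT.HodgeTheaters Literature.IUT.LogVolume.ThetaData
  Literature.NumberTheory.DiophantineGeometry.GenEll Summit.ABC.ABC.Theorems
  Summit.ABC.IUTFork.Repair.RH.SigmaLicence Summit.ABC.IUTFork.Repair.RH.SigmaStrataEq Summit.ABC.IUTFork.Repair.RH.SigmaMass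
  Summit.ABC.IUTFork.Repair.RH.OffSigma Summit.ABC.IUTFork.Conditional
/-! ## [MU] in mass currency at the datum · the `μ₀ = 1` regression · the empty stratum · monotonicity in `μ₀` -/

/-- **[MU] IN MASS CURRENCY — `μ` EXPLICIT AT THE DATUM.** At the bed of a genuine Θ-volume datum `T` with the chosen ideles, for EVERY stratum `σ` and
every `μ₀`: `OffSigmaTolerance (1−μ₀) (Tol(P,l)) T (B_triv(σᶜ))` ⟺ **`μ₀·T.gap ≤ mass(σ) + Tol(P,l)`** — abc-iut-rh2-w-1's knapsack identity in gap currency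
`mass(σ) + B_triv(σᶜ) = T.gap` (p478601). READING (EXP-SPEC §0): with `μ(T) := mass(Σ_data)/T.gap` this is «`μ(T) ≥ μ₀ − Tol(P,l)/T.gap`»; for the
initial-label-segment strata of every kept row `mass(Σ_data) = (Σᶠ_v S(j₀(v))·h_v)/l⋆`, `S(n) = n(n−1)(2n+5)/6`, by w-1's `RH.CellWeights.mass_labelSegment_eq`
(p477616; cited, not restated), so `μ(T) = Σ_v S(j₀(v))·h_v/(S(l⋆)·Σ_v h_v)` — the number MIN-SLICE (iii) tabulates. [claim: Mochizuki2012, status: disputed] -/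
theorem offSigmaTolerance_offTrivialMass_chosen_iff {P : NFPoint} {l : ℕ} (T : Cor22.ThetaVolumeDatumAt P l) (μ₀ : ℝ) :
    letI := T.instFieldF; letI := T.instNumberFieldF; letI := T.instAlgebraF; letI := T.instFieldK;
        letI := T.instNumberFieldK; letI := T.instAlgebraK; letI := T.instFieldFbar; letI := T.instAlgebraFbar;
        letI := T.instAlgebraKFbar; letI := T.instIsElliptic;
    ∀ (M : Type) [Field M] [NumberField M]
      (archPk : ∀ (j : (thetaIndex (pilotDataOfK T.D T.K)).Label) (vQ : (thetaIndex (pilotDataOfK T.D T.K)).VQ),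
        Set ((logShellsDH (pilotDataOfK T.D T.K) (analyticLogv T.K)).Packet j vQ))
      (archSub : ∀ (j : (thetaIndex (pilotDataOfK T.D T.K)).Label) (v : (thetaIndex (pilotDataOfK T.D T.K)).V),
        Set ((logShellsDH (pilotDataOfK T.D T.K) (analyticLogv T.K)).Packet j ((thetaIndex (pilotDataOfK T.D T.K)).over v)))
      (Ψ : ℤ → ∀ v : (thetaIndex (pilotDataOfK T.D T.K)).V, v ∈ (thetaIndex (pilotDataOfK T.D T.K)).Vbad →
        Set ((logShellsDH (pilotDataOfK T.D T.K) (analyticLogv T.K)).StarPacket v))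
      (act : ℤ → ∀ v : (thetaIndex (pilotDataOfK T.D T.K)).V, v ∈ (thetaIndex (pilotDataOfK T.D T.K)).Vbad →
        (logShellsDH (pilotDataOfK T.D T.K) (analyticLogv T.K)).StarPacket v →
          Module.End ℚ ((logShellsDH (pilotDataOfK T.D T.K) (analyticLogv T.K)).StarPacket v))
      (Mmod : ℤ → ∀ j : (thetaIndex (pilotDataOfK T.D T.K)).LabelStar,
        Set ((logShellsDH (pilotDataOfK T.D T.K) (analyticLogv T.K)).GlobalPacket j.1))
      (region : ℤ → ∀ j : (thetaIndex (pilotDataOfK T.D T.K)).LabelStar, FinDivisor M →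
        ∀ vQ : (thetaIndex (pilotDataOfK T.D T.K)).VQ, Set ((logShellsDH (pilotDataOfK T.D T.K) (analyticLogv T.K)).Packet j.1 vQ))
      (n : ℤ) {HT : Type} {LogLink : HT → HT → Type} {IsFull : ∀ {s t : HT}, LogLink s t → Prop}
      (lat : LGPGaussianLogThetaLattice LogLink IsFull)
      {Frd : Type} {IsoF : Frd → Frd → Type} {Ob : Frd → Type} {realify : Frd → Frd} {Strip : Type}
      {IsoS : Strip → Strip → Type}
      {Mv : ∀ v : (thetaIndex (pilotDataOfK T.D T.K)).V, v ∈ (thetaIndex (pilotDataOfK T.D T.K)).Vbad → Type}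
      [∀ v h, Monoid (Mv v h)]
      (sig : GlobalLGPFrobenioidSignature (thetaIndex (pilotDataOfK T.D T.K)).lstar (thetaIndex (pilotDataOfK T.D T.K)).V
        (· ∈ (thetaIndex (pilotDataOfK T.D T.K)).Vbad) Frd IsoF Ob realify Strip IsoS Mv)
      (split : SplittingMonoids Mv) {ObΔ : Type}
      {N : ∀ v : (thetaIndex (pilotDataOfK T.D T.K)).V, v ∈ (thetaIndex (pilotDataOfK T.D T.K)).Vbad → Type} [∀ v h, Monoid (N v h)]
      (qData : QPilotData ObΔ N)
      (σ : Set (Fin (thetaIndex (pilotDataOfK T.D T.K)).lstar × (thetaIndex (pilotDataOfK T.D T.K)).VQ)),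
      OffSigmaTolerance (1 - μ₀) (tol P l) T
          (offTrivialMass
            (settingPrVolSharp (pilotDataOfK T.D T.K) (logvAnalytic_analyticLogv (F := T.K)) M archPk archSub Ψ act Mmod region n lat
            sig split qData (exists_realising_qIdeles_pilotDataOfK T.D).choose (exists_realising_thetaIdeles_pilotDataOfK T.D).choose
            (exists_realising_qIdeles_pilotDataOfK T.D).choose_spec.1 (exists_realising_qIdeles_pilotDataOfK T.D).choose_spec.2.1) σ) ↔
        μ₀ * T.gap ≤
          onTrivialMass
            (settingPrVolSharp (pilotDataOfK T.D T.K) (logvAnalytic_analyticLogv (F := T.K)) M archPk archSub Ψ act Mmod region n lat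
            sig split qData (exists_realising_qIdeles_pilotDataOfK T.D).choose (exists_realising_thetaIdeles_pilotDataOfK T.D).choose
            (exists_realising_qIdeles_pilotDataOfK T.D).choose_spec.1 (exists_realising_qIdeles_pilotDataOfK T.D).choose_spec.2.1) σ + tol P l := by
  intro M _ _ archPk archSub Ψ act Mmod region n HT LogLink IsFull lat Frd IsoF Ob realify Strip IsoS Mv _ sig split ObΔ N _ qData σ
  letI := T.instFieldF; letI := T.instNumberFieldF; letI := T.instAlgebraF; letI := T.instFieldK
  letI := T.instNumberFieldK; letI := T.instAlgebraK; letI := T.instFieldFbar; letI := T.instAlgebraFbar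
  letI := T.instAlgebraKFbar; letI := T.instIsElliptic
  have h := Repair.RH.CellWeights.onTrivialMass_add_offTrivialMass_chosen_eq_gap T M archPk archSub Ψ act Mmod region n lat sig split qData σ
  unfold OffSigmaTolerance
  have e : (1 - μ₀) * T.gap = T.gap - μ₀ * T.gap := by ring
  rw [e]
  constructor <;> intro h' <;> linarith

/-- **THE `μ₀ = 1` REGRESSION**: `OffSigmaTolerance (1 − 1) A T B ⟺ B ≤ A` — [MU-C] at `μ₀ = 1` IS the no-loss [THR-C] «`B_triv(σᶜ) ≤ Tol(P,l)`» of this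
seat's record endpoint `abc_of_licenceOn_of_offTrivialMass_le_content_hregC` (p477900), so the companion's pointwise theorem at `μ₀ = 1` has exactly p477900's three binders and
concludes print's UNDILATED display (`1/1 = 1`). [folklore] -/
theorem offSigmaTolerance_sub_self_iff {P : NFPoint} {l : ℕ} (T : Cor22.ThetaVolumeDatumAt P l) (A B : ℝ) :
    OffSigmaTolerance (1 - 1) A T B ↔ B ≤ A := by
  unfold OffSigmaTolerance
  constructor <;> intro h <;> linarith

/-- **THE EMPTY STRATUM (rh2-ref-3's μ₀-family sanity, as a kernel sentence)**: at the bed with the chosen ideles, [MU] at `σ = ∅` ⟺ **`μ₀·T.gap ≤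
Tol(P,l)`** (`mass(∅) = 0`). So for every FIXED `μ₀ > 0` the licence-free stratum satisfies [MU-C] only at data of gap `≤ Tol(P,l)/μ₀` — bounded height
at each `l` (`T.gap = ((l+1)/24 − 1/(2l))·log q^{∤{2,l}}`, `Tol(P,l) = 691200·d_mod·l(l+1)`): the pointwise theorem is not junk-inhabited high on the content locus, and a
small `μ₀` trades a weaker hypothesis for a weaker conclusion (`1/μ₀`-dilated display). [folklore] -/
theorem offSigmaTolerance_offTrivialMass_empty_chosen_iff {P : NFPoint} {l : ℕ} (T : Cor22.ThetaVolumeDatumAt P l) (μ₀ : ℝ) :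
    letI := T.instFieldF; letI := T.instNumberFieldF; letI := T.instAlgebraF; letI := T.instFieldK;
        letI := T.instNumberFieldK; letI := T.instAlgebraK; letI := T.instFieldFbar; letI := T.instAlgebraFbar;
        letI := T.instAlgebraKFbar; letI := T.instIsElliptic;
    ∀ (M : Type) [Field M] [NumberField M]
      (archPk : ∀ (j : (thetaIndex (pilotDataOfK T.D T.K)).Label) (vQ : (thetaIndex (pilotDataOfK T.D T.K)).VQ),
        Set ((logShellsDH (pilotDataOfK T.D T.K) (analyticLogv T.K)).Packet j vQ))
      (archSub : ∀ (j : (thetaIndex (pilotDataOfK T.D T.K)).Label) (v : (thetaIndex (pilotDataOfK T.D T.K)).V),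
        Set ((logShellsDH (pilotDataOfK T.D T.K) (analyticLogv T.K)).Packet j ((thetaIndex (pilotDataOfK T.D T.K)).over v)))
      (Ψ : ℤ → ∀ v : (thetaIndex (pilotDataOfK T.D T.K)).V, v ∈ (thetaIndex (pilotDataOfK T.D T.K)).Vbad →
        Set ((logShellsDH (pilotDataOfK T.D T.K) (analyticLogv T.K)).StarPacket v))
      (act : ℤ → ∀ v : (thetaIndex (pilotDataOfK T.D T.K)).V, v ∈ (thetaIndex (pilotDataOfK T.D T.K)).Vbad →
        (logShellsDH (pilotDataOfK T.D T.K) (analyticLogv T.K)).StarPacket v →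
          Module.End ℚ ((logShellsDH (pilotDataOfK T.D T.K) (analyticLogv T.K)).StarPacket v))
      (Mmod : ℤ → ∀ j : (thetaIndex (pilotDataOfK T.D T.K)).LabelStar,
        Set ((logShellsDH (pilotDataOfK T.D T.K) (analyticLogv T.K)).GlobalPacket j.1))
      (region : ℤ → ∀ j : (thetaIndex (pilotDataOfK T.D T.K)).LabelStar, FinDivisor M →
        ∀ vQ : (thetaIndex (pilotDataOfK T.D T.K)).VQ, Set ((logShellsDH (pilotDataOfK T.D T.K) (analyticLogv T.K)).Packet j.1 vQ))
      (n : ℤ) {HT : Type} {LogLink : HT → HT → Type} {IsFull : ∀ {s t : HT}, LogLink s t → Prop}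
      (lat : LGPGaussianLogThetaLattice LogLink IsFull)
      {Frd : Type} {IsoF : Frd → Frd → Type} {Ob : Frd → Type} {realify : Frd → Frd} {Strip : Type}
      {IsoS : Strip → Strip → Type}
      {Mv : ∀ v : (thetaIndex (pilotDataOfK T.D T.K)).V, v ∈ (thetaIndex (pilotDataOfK T.D T.K)).Vbad → Type}
      [∀ v h, Monoid (Mv v h)]
      (sig : GlobalLGPFrobenioidSignature (thetaIndex (pilotDataOfK T.D T.K)).lstar (thetaIndex (pilotDataOfK T.D T.K)).V
        (· ∈ (thetaIndex (pilotDataOfK T.D T.K)).Vbad) Frd IsoF Ob realify Strip IsoS Mv)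
      (split : SplittingMonoids Mv) {ObΔ : Type}
      {N : ∀ v : (thetaIndex (pilotDataOfK T.D T.K)).V, v ∈ (thetaIndex (pilotDataOfK T.D T.K)).Vbad → Type} [∀ v h, Monoid (N v h)]
      (qData : QPilotData ObΔ N),
      OffSigmaTolerance (1 - μ₀) (tol P l) T
          (offTrivialMass
            (settingPrVolSharp (pilotDataOfK T.D T.K) (logvAnalytic_analyticLogv (F := T.K)) M archPk archSub Ψ act Mmod region n lat
            sig split qData (exists_realising_qIdeles_pilotDataOfK T.D).choose (exists_realising_thetaIdeles_pilotDataOfK T.D).choose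
            (exists_realising_qIdeles_pilotDataOfK T.D).choose_spec.1 (exists_realising_qIdeles_pilotDataOfK T.D).choose_spec.2.1) ∅) ↔
        μ₀ * T.gap ≤ tol P l := by
  intro M _ _ archPk archSub Ψ act Mmod region n HT LogLink IsFull lat Frd IsoF Ob realify Strip IsoS Mv _ sig split ObΔ N _ qData
  letI := T.instFieldF; letI := T.instNumberFieldF; letI := T.instAlgebraF; letI := T.instFieldK
  letI := T.instNumberFieldK; letI := T.instAlgebraK; letI := T.instFieldFbar; letI := T.instAlgebraFbar
  letI := T.instAlgebraKFbar; letI := T.instIsElliptic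
  have h := Repair.RH.CellWeights.onTrivialMass_add_offTrivialMass_chosen_eq_gap T M archPk archSub Ψ act Mmod region n lat sig split qData ∅
  have H := bridgeHyps_settingPrVolSharp_of_ideles (pilotDataOfK T.D T.K) (logvAnalytic_analyticLogv (F := T.K)) M archPk archSub Ψ act
    Mmod region n lat sig split qData (exists_realising_thetaIdeles_pilotDataOfK T.D).choose (exists_realising_qIdeles_pilotDataOfK T.D).choose
    (exists_realising_thetaIdeles_pilotDataOfK T.D).choose_spec.1 (exists_realising_thetaIdeles_pilotDataOfK T.D).choose_spec.2.1
    (exists_realising_qIdeles_pilotDataOfK T.D).choose_spec.1 (exists_realising_qIdeles_pilotDataOfK T.D).choose_spec.2.1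
  have h0 := onTrivialMass_add_offTrivialMass H (∅ : Set (Fin (thetaIndex (pilotDataOfK T.D T.K)).lstar × (thetaIndex (pilotDataOfK T.D T.K)).VQ))
  rw [offTrivialMass_empty] at h0
  have hm0 : onTrivialMass
      (settingPrVolSharp (pilotDataOfK T.D T.K) (logvAnalytic_analyticLogv (F := T.K)) M archPk archSub Ψ act Mmod region n lat
            sig split qData (exists_realising_qIdeles_pilotDataOfK T.D).choose (exists_realising_thetaIdeles_pilotDataOfK T.D).choose
            (exists_realising_qIdeles_pilotDataOfK T.D).choose_spec.1 (exists_realising_qIdeles_pilotDataOfK T.D).choose_spec.2.1) ∅ = 0 := by linarith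
  rw [hm0, zero_add] at h
  unfold OffSigmaTolerance
  rw [h]
  have e : (1 - μ₀) * T.gap + tol P l = T.gap - μ₀ * T.gap + tol P l := by ring
  rw [e]
  constructor <;> intro h' <;> linarith

/-- **MONOTONICITY IN `μ₀`**: for `T.gap ≥ 0`, `κ ≤ κ'` ⟹ `OffSigmaTolerance κ A T B ⟹ OffSigmaTolerance κ' A T B` — a SMALLER `μ₀` (larger `κ = 1 − μ₀`)
is a WEAKER hypothesis [MU-C] (and the pointwise theorem then concludes a weaker, more dilated display). [folklore] -/
theorem offSigmaTolerance_mono_kappa {P : NFPoint} {l : ℕ} (T : Cor22.ThetaVolumeDatumAt P l) {κ κ' A B : ℝ} (hκ : κ ≤ κ')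
    (hgap : 0 ≤ T.gap) (h : OffSigmaTolerance κ A T B) : OffSigmaTolerance κ' A T B := by
  unfold OffSigmaTolerance at h ⊢
  nlinarith

/-- `T.gap ≥ 0` at a genuine datum of `λ ∈ U_X` with `l ≥ 3` (`T.gap = ((l+1)/24 − 1/(2l))·log q^{∤{2,l}}`, abc-iut-S-d2 `PointDict.gap_eq`;
`log q^{∤{2,l}} ≥ 0`). [folklore] -/
theorem gap_nonneg_of_three_le {P : NFPoint} {l : ℕ} (T : Cor22.ThetaVolumeDatumAt P l) (hU : P.InU) (h3 : 3 ≤ l) : 0 ≤ T.gap := by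
  rw [PointDict.gap_eq T hU]
  have hl3 : (3 : ℝ) ≤ l := by exact_mod_cast h3
  have hl0 : (0 : ℝ) < l := by linarith
  have hc : 0 ≤ ((l : ℝ) + 1) / 24 - 1 / (2 * l) := by
    rw [sub_nonneg, div_le_div_iff₀ (by positivity) (by positivity)]
    nlinarith
  exact mul_nonneg hc (Cor22.logQAvoid_nonneg P {2, l})

end Summit.ABC.IUTFork.Conditional.SigmaMass

end
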